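import Mathlib
import Summits.ResolutionOfSingularities.ResolutionOfSingularities.Theorems.WildQuotientsWildQuotientResolutionThird112ChartA3
import Summits.ResolutionOfSingularities.ResolutionOfSingularities.Theorems.WildQuotientsWildQuotientResolutionJordanThreeChartsA
import Summits.ResolutionOfSingularities.ResolutionOfSingularities.Theorems.WildQuotientsWildQuotientResolutionToricExitRootSubstInjective

/-!
# V4U `μ₃`-exit: the vertex chart `D₊(y₃³ t)` of the one blow-up of `⅓(1,1,2) × 𝔸^{n−3}` is regular

(crux stmt-ResolutionOfSingularities-15640 `WildQuotients.WildQuotientResolution`, line `Sketch`,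
sector `|G| = p`; programme V4U of `L/w45c/CHAIN.md` v5 — stub-4 FINDING V4U-μ₃/μ₂-EXIT
2026-08-27T04:2xZ (toric certificate `L/res-L1-w45c-stub-4/toric/third3.py`): the blow-up of
`Spec R₃`, `R₃ = k[y₁³, y₂³, y₃³, y₁²y₂, y₁y₂², y₁y₃, y₂y₃]`, along the ideal of its seven generators
is regular, with five vertex charts. [OURS · L1 W4.5c] — NOT a statement of any manuscript; replaces
the role of no printed item. Prover res-L1-w45c-stub-4.)

Same template as `…Third112ChartA3` (`D₊(y₁³ t)`): `D₊(y₃³ t)` has chart ring the polynomial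
ring `k[u₁ = y₁/y₃², u₂ = y₂/y₃², u₃ = y₃³, passengers]`; in it `y₁³ = u₁³u₃²`, `y₂³ = u₂³u₃²`,
`y₁²y₂ = u₁²u₂u₃²`, `y₁y₂² = u₁u₂²u₃²`, `y₁y₃ = u₁u₃`, `y₂y₃ = u₂u₃`; chart map `X a ↦ u₁`,
`X b ↦ u₂`, `X c ↦ u₃`; root substitution `ψ : y ↦ (u₁t², u₂t², t)`, retraction onto `X c ↦ X c³`.
-/

-- single-problem summit: the doubled namespace component `ResolutionOfSingularities` is forced
set_option linter.dupNamespace false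

noncomputable section

open MvPolynomial IsLocalization
open Literature.AlgebraicGeometry.Resolution

namespace Summit.ResolutionOfSingularities.ResolutionOfSingularities.Theorems.WildQuotientResolution.Third112

universe u

variable (k : Type) [Field k] (n : ℕ) (a b c : Fin n)

-- seven monomial identities in the localisation, each a two-line consequence of a relation
set_option maxHeartbeats 800000 in
/-- **Chart `D₊(y₃³ t)` of `Bl_𝔪 (⅓(1,1,2) × 𝔸^{n−3})` is regular** (chart ring
`= k[y₁/y₃², y₂/y₃², y₃³, passengers]`). [OURS · L1 W4.5c] -/
theorem isRegularRing_chartRing_two (hab : a ≠ b) (hbc : b ≠ c) (hac : a ≠ c) :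
    IsRegularRing (chartRing (fun l : Fin 7 =>
      Ideal.Quotient.mk (RingHom.ker (presentation k n a b c)) (gens k n a b c l)) 2) := by
  classical
  -- notation
  let P := MvPolynomial (Fin n ⊕ Fin 4) k
  let Φ : P →ₐ[k] MvPolynomial (Fin n) k := presentation k n a b c
  let J : Ideal P := RingHom.ker (presentation k n a b c)
  let π : P →ₐ[k] P ⧸ J := Ideal.Quotient.mkₐ k J
  let cc : Fin 7 → P ⧸ J := fun l => Ideal.Quotient.mk J (gens k n a b c l)
  change IsRegularRing (chartRing cc 2)
  let L := Localization.Away (cc 2)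
  let am : (P ⧸ J) →+* L := algebraMap _ L
  let ι : L := Away.invSelf (cc 2)
  have hπ : ∀ F : P, π F = Ideal.Quotient.mk J F := fun F => rfl
  have hinv : am (cc 2) * ι = 1 := Away.mul_invSelf (S := L) (cc 2)
  have hba : b ≠ a := fun h => hab h.symm
  have hca : c ≠ a := fun h => hac h.symm
  have hcb : c ≠ b := fun h => hbc h.symm
  haveI : IsRegularRing (MvPolynomial (Fin n) k) := MvPolynomial.isRegularRing_of_isRegularRing k
  -- the presentation on the symbols
  have hΦ : ∀ l : Fin 7, Φ (gens k n a b c l) =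
      (![X a ^ 3, X b ^ 3, X c ^ 3, X a ^ 2 * X b, X a * X b ^ 2, X a * X c, X b * X c] :
        Fin 7 → MvPolynomial (Fin n) k) l := presentation_gens k n a b c hab hbc hac
  have hΦi : ∀ i, i ≠ a → i ≠ b → i ≠ c → Φ (X (Sum.inl i)) = X i :=
    fun i hia hib hic => presentation_inl_of_ne k n a b c i hia hib hic
  -- relations: `π F = π G` from `Φ F = Φ G`
  have hrel : ∀ {F G : P}, Φ F = Φ G → am (π F) = am (π G) := fun h =>
    congrArg am (mk_eq_of_presentation_eq k n a b c h)
  have hcc : ∀ l, am (cc l) = am (π (gens k n a b c l)) := fun l => rfl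
  -- the symbols as chart generators
  have hc0 : am (π (X (Sum.inl a))) = am (cc 0) := rfl
  have hc1 : am (π (X (Sum.inl b))) = am (cc 1) := rfl
  have hc2 : am (π (X (Sum.inl c))) = am (cc 2) := rfl
  have hc3 : am (π (X (Sum.inr 0))) = am (cc 3) := rfl
  have hc4 : am (π (X (Sum.inr 1))) = am (cc 4) := rfl
  have hc5 : am (π (X (Sum.inr 2))) = am (cc 5) := rfl
  have hc6 : am (π (X (Sum.inr 3))) = am (cc 6) := rfl
  -- the four relations used (monomial identities in `k[x]`)
  have ra : am (cc 5) ^ 3 * am (cc 2) ^ 2 = am (cc 0) * am (cc 2) ^ 3 := by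
    have h := hrel (F := X (Sum.inr 2) ^ 3 * X (Sum.inl c) ^ 2)
      (G := X (Sum.inl a) * X (Sum.inl c) ^ 3) (by
      show presentation k n a b c _ = presentation k n a b c _
      rw [map_mul, map_pow, map_pow, map_mul, map_pow, presentation_inr_two,
        presentation_inl_c k n a b c hac hbc, presentation_inl_a]
      ring)
    rw [map_mul, map_mul, map_pow, map_pow, map_pow, map_pow, map_mul, map_mul, map_pow, map_pow,
      hc5, hc2, hc0] at h
    exact h
  have rb : am (cc 6) ^ 3 * am (cc 2) ^ 2 = am (cc 1) * am (cc 2) ^ 3 := by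
    have h := hrel (F := X (Sum.inr 3) ^ 3 * X (Sum.inl c) ^ 2)
      (G := X (Sum.inl b) * X (Sum.inl c) ^ 3) (by
      show presentation k n a b c _ = presentation k n a b c _
      rw [map_mul, map_pow, map_pow, map_mul, map_pow, presentation_inr_three,
        presentation_inl_c k n a b c hac hbc, presentation_inl_b k n a b c hab]
      ring)
    rw [map_mul, map_mul, map_pow, map_pow, map_pow, map_pow, map_mul, map_mul, map_pow, map_pow,
      hc6, hc2, hc1] at h
    exact h
  have r3 : am (cc 5) ^ 2 * am (cc 6) * am (cc 2) ^ 2 = am (cc 3) * am (cc 2) ^ 3 := by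
    have h := hrel (F := X (Sum.inr 2) ^ 2 * X (Sum.inr 3) * X (Sum.inl c) ^ 2)
      (G := X (Sum.inr 0) * X (Sum.inl c) ^ 3) (by
      show presentation k n a b c _ = presentation k n a b c _
      rw [map_mul, map_mul, map_pow, map_pow, map_mul, map_pow, presentation_inr_two,
        presentation_inr_three, presentation_inl_c k n a b c hac hbc, presentation_inr_zero]
      ring)
    rw [map_mul, map_mul, map_mul, map_mul, map_pow, map_pow, map_pow, map_pow, map_mul, map_mul,
      map_pow, map_pow, hc5, hc6, hc2, hc3] at h
    exact h
  have r4 : am (cc 5) * am (cc 6) ^ 2 * am (cc 2) ^ 2 = am (cc 4) * am (cc 2) ^ 3 := by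
    have h := hrel (F := X (Sum.inr 2) * X (Sum.inr 3) ^ 2 * X (Sum.inl c) ^ 2)
      (G := X (Sum.inr 1) * X (Sum.inl c) ^ 3) (by
      show presentation k n a b c _ = presentation k n a b c _
      rw [map_mul, map_mul, map_pow, map_pow, map_mul, map_pow, presentation_inr_two,
        presentation_inr_three, presentation_inl_c k n a b c hac hbc, presentation_inr_one]
      ring)
    rw [map_mul, map_mul, map_mul, map_mul, map_pow, map_pow, map_pow, map_pow, map_mul, map_mul,
      map_pow, map_pow, hc5, hc6, hc2, hc4] at h
    exact h
  -- the chart map `X a ↦ u₁ = y₁/y₃²`, `X b ↦ u₂ = y₂/y₃²`, `X c ↦ u₃ = y₃³`, passengers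
  let v : Fin n → L := fun i =>
    if i = a then am (cc 5) * ι else if i = b then am (cc 6) * ι else if i = c then am (cc 2)
      else am (π (X (Sum.inl i)))
  let φ : MvPolynomial (Fin n) k →ₐ[k] L := aeval v
  have hφa : φ (X a) = am (cc 5) * ι := by simp [φ, v]
  have hφb : φ (X b) = am (cc 6) * ι := by simp [φ, v, hba]
  have hφc : φ (X c) = am (cc 2) := by simp [φ, v, hca, hcb]
  have hφi : ∀ i, i ≠ a → i ≠ b → i ≠ c → φ (X i) = am (π (X (Sum.inl i))) :=
    fun i hia hib hic => by simp [φ, v, hia, hib, hic]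
  have hπC : ∀ r : k, π (C r) = algebraMap k _ r := fun r => π.commutes r
  have hφC : ∀ r : k, φ (C r) = am (π (C r)) := by
    intro r
    have h1 : φ (C r) = algebraMap k L r := aeval_C v r
    rw [h1, hπC, IsScalarTower.algebraMap_apply k (P ⧸ J) L]
  -- the root substitution `ψ : y ↦ (u₁ t², u₂ t², t)` and the retraction
  let w : Fin n → MvPolynomial (Fin n) k := fun s =>
    if s = c then X c else X s * X c ^ (if s = a then 2 else if s = b then 2 else 0)
  let ψ : MvPolynomial (Fin n) k →ₐ[k] MvPolynomial (Fin n) k := aeval w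
  have hψa : ψ (X a) = X a * X c ^ 2 := by simp [ψ, w, hac]
  have hψb : ψ (X b) = X b * X c ^ 2 := by simp [ψ, w, hbc, hba]
  have hψc : ψ (X c) = X c := by simp [ψ, w]
  have hψi : ∀ i, i ≠ a → i ≠ b → i ≠ c → ψ (X i) = X i := fun i hia hib hic => by
    simp [ψ, w, hia, hib, hic]
  let θ₀ : P →ₐ[k] MvPolynomial (Fin n) k := ψ.comp Φ
  have hθJ : ∀ x ∈ J, θ₀ x = 0 := by
    intro x hx
    change ψ (presentation k n a b c x) = 0
    rw [RingHom.mem_ker] at hx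
    change presentation k n a b c x = 0 at hx
    rw [hx, map_zero]
  let θ : (P ⧸ J) →ₐ[k] MvPolynomial (Fin n) k := Ideal.Quotient.liftₐ J θ₀ hθJ
  have hθπ : ∀ x, θ (π x) = ψ (Φ x) := fun x => rfl
  have hθ0 : θ (cc 2) = X c ^ 3 := by
    change θ (π (gens k n a b c 2)) = _
    rw [hθπ, hΦ]; simp [hψc]
  have hθ3 : θ (cc 5) = X c ^ 3 * X a := by
    change θ (π (gens k n a b c 5)) = _
    rw [hθπ, hΦ]; simp [hψa, hψc]; ring
  have hθ5 : θ (cc 6) = X c ^ 3 * X b := by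
    change θ (π (gens k n a b c 6)) = _
    rw [hθπ, hΦ]; simp [hψb, hψc]; ring
  have hθC : ∀ r : k, θ (π (C r)) = C r := fun r => by
    rw [hθπ]
    change ψ (presentation k n a b c (algebraMap k P r)) = algebraMap k (MvPolynomial (Fin n) k) r
    rw [AlgHom.commutes, AlgHom.commutes]
  have hθi : ∀ i, i ≠ a → i ≠ b → i ≠ c → θ (π (X (Sum.inl i))) = X i := fun i hia hib hic => by
    rw [hθπ]
    change ψ (presentation k n a b c (X (Sum.inl i))) = X i
    rw [hΦi i hia hib hic, hψi i hia hib hic]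
  -- injectivity: extend `θ` to `A[1/y₃³] → k[x][1/x_c]`; it retracts `φ` onto `X c ↦ X c³`
  let A' := Localization.Away (X c : MvPolynomial (Fin n) k)
  let alg : MvPolynomial (Fin n) k →+* A' := algebraMap _ A'
  have hunit : IsUnit ((alg.comp (θ : (P ⧸ J) →+* MvPolynomial (Fin n) k)) (cc 2)) := by
    change IsUnit (alg (θ (cc 2)))
    rw [hθ0, map_pow]
    exact (IsLocalization.Away.algebraMap_isUnit (S := A') (X c)).pow 3
  let Θ : L →+* A' := IsLocalization.Away.lift (cc 2) hunit
  have hΘam : ∀ r, Θ (am r) = alg (θ r) := fun r => IsLocalization.Away.lift_eq (cc 2) hunit r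
  have hΘι : alg (X c) ^ 3 * Θ ι = 1 := by
    have h : Θ (am (cc 2) * ι) = 1 := by rw [Away.mul_invSelf, map_one]
    rw [map_mul, hΘam, hθ0, map_pow] at h
    exact h
  let E : MvPolynomial (Fin n) k →ₐ[k] MvPolynomial (Fin n) k :=
    aeval fun s => if s = c then X c ^ 3 else X s
  have hEa : E (X c) = X c ^ 3 := by simp [E]
  have hEi : ∀ i, i ≠ c → E (X i) = X i := fun i hi => by simp [E, hi]
  have hEC : ∀ r : k, E (C r) = C r := fun r => aeval_C _ r
  have hΘφ' : Θ.comp (φ : MvPolynomial (Fin n) k →+* L) =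
      alg.comp (E : MvPolynomial (Fin n) k →+* MvPolynomial (Fin n) k) := by
    refine MvPolynomial.ringHom_ext (fun r => ?_) (fun i => ?_)
    · simp only [RingHom.coe_comp, RingHom.coe_coe, Function.comp_apply, hφC, hΘam, hθC, hEC]
    · simp only [RingHom.coe_comp, RingHom.coe_coe, Function.comp_apply]
      by_cases hia : i = a
      · rw [hia, hφa, map_mul, hΘam, hθ3, hEi a hac, map_mul, map_pow]
        linear_combination (alg (X a)) * hΘι
      · by_cases hib : i = b
        · rw [hib, hφb, map_mul, hΘam, hθ5, hEi b hbc, map_mul, map_pow]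
          linear_combination (alg (X b)) * hΘι
        · by_cases hic : i = c
          · rw [hic, hφc, hΘam, hθ0, hEa]
          · rw [hφi i hia hib hic, hΘam, hθi i hia hib hic, hEi i hic]
  have hΘφ : ∀ r, Θ (φ r) = alg (E r) := fun r => RingHom.congr_fun hΘφ' r
  have hinj : Function.Injective (φ : MvPolynomial (Fin n) k →+* L) := by
    intro p q hpq
    have h1 : alg (E p) = alg (E q) := by
      rw [← hΘφ, ← hΘφ]
      exact congrArg Θ hpq
    have h2 : E p = E q := JordanThree.algebraMap_away_injective k n (X c) (X_ne_zero c) h1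
    exact ToricExit.powSubst_injective k n c 3 (by norm_num) h2
  -- values in the blow-up algebra
  have hmem : ∀ p, (φ : MvPolynomial (Fin n) k →+* L) p ∈
      blowupAlgebra (Ideal.span (Set.range cc)) (cc 2) := by
    intro p
    induction p using MvPolynomial.induction_on with
    | C r =>
      rw [RingHom.coe_coe, hφC]
      exact Subalgebra.algebraMap_mem _ _
    | add p q hp hq =>
      rw [map_add]
      exact Subalgebra.add_mem _ hp hq
    | mul_X p i hp =>
      rw [map_mul]
      refine Subalgebra.mul_mem _ hp ?_
      by_cases hia : i = a
      · rw [hia, RingHom.coe_coe, hφa]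
        exact div_mem_blowupAlgebra _ _ (Ideal.subset_span ⟨5, rfl⟩)
      · by_cases hib : i = b
        · rw [hib, RingHom.coe_coe, hφb]
          exact div_mem_blowupAlgebra _ _ (Ideal.subset_span ⟨6, rfl⟩)
        · by_cases hic : i = c
          · rw [hic, RingHom.coe_coe, hφc]
            exact Subalgebra.algebraMap_mem _ _
          · rw [RingHom.coe_coe, hφi i hia hib hic]
            exact Subalgebra.algebraMap_mem _ _
  -- every element of the base is a value of the chart map (seven monomial identities)
  have hsymb : ∀ s : Fin n ⊕ Fin 4, am (π (X s)) ∈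
      Set.range (φ : MvPolynomial (Fin n) k →+* L) := by
    rintro (i | j)
    · by_cases hia : i = a
      · subst hia
        refine ⟨X i ^ 3 * X c ^ 2, ?_⟩
        rw [RingHom.coe_coe, map_mul, map_pow, map_pow, hφa, hφc, hc0]
        linear_combination (ι ^ 3) * ra +
          (am (cc 0) * ((am (cc 2) * ι) ^ 2 + am (cc 2) * ι + 1)) * hinv
      by_cases hib : i = b
      · subst hib
        refine ⟨X i ^ 3 * X c ^ 2, ?_⟩
        rw [RingHom.coe_coe, map_mul, map_pow, map_pow, hφb, hφc, hc1]
        linear_combination (ι ^ 3) * rb +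
          (am (cc 1) * ((am (cc 2) * ι) ^ 2 + am (cc 2) * ι + 1)) * hinv
      by_cases hic : i = c
      · subst hic
        exact ⟨X i, by rw [RingHom.coe_coe, hφc]; exact hc2.symm⟩
      · exact ⟨X i, by rw [RingHom.coe_coe, hφi i hia hib hic]⟩
    · fin_cases j
      · refine ⟨X a ^ 2 * X b * X c ^ 2, ?_⟩
        rw [RingHom.coe_coe, map_mul, map_mul, map_pow, map_pow, hφa, hφb, hφc]
        change _ = am (π (X (Sum.inr 0)))
        rw [hc3]
        linear_combination (ι ^ 3) * r3 +
          (am (cc 3) * ((am (cc 2) * ι) ^ 2 + am (cc 2) * ι + 1)) * hinv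
      · refine ⟨X a * X b ^ 2 * X c ^ 2, ?_⟩
        rw [RingHom.coe_coe, map_mul, map_mul, map_pow, map_pow, hφa, hφb, hφc]
        change _ = am (π (X (Sum.inr 1)))
        rw [hc4]
        linear_combination (ι ^ 3) * r4 +
          (am (cc 4) * ((am (cc 2) * ι) ^ 2 + am (cc 2) * ι + 1)) * hinv
      · refine ⟨X a * X c, ?_⟩
        rw [RingHom.coe_coe, map_mul, hφa, hφc]
        change _ = am (π (X (Sum.inr 2)))
        rw [hc5]
        linear_combination (am (cc 5)) * hinv
      · refine ⟨X b * X c, ?_⟩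
        rw [RingHom.coe_coe, map_mul, hφb, hφc]
        change _ = am (π (X (Sum.inr 3)))
        rw [hc6]
        linear_combination (am (cc 6)) * hinv
  have hbase : ∀ r : P ⧸ J, am r ∈ Set.range (φ : MvPolynomial (Fin n) k →+* L) := by
    intro r
    obtain ⟨F, rfl⟩ := Ideal.Quotient.mk_surjective r
    change am (π F) ∈ _
    induction F using MvPolynomial.induction_on with
    | C r => exact ⟨C r, by rw [RingHom.coe_coe, hφC]⟩
    | add p q hp hq =>
      obtain ⟨p', hp'⟩ := hp
      obtain ⟨q', hq'⟩ := hq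
      exact ⟨p' + q', by rw [map_add, hp', hq', map_add, map_add]⟩
    | mul_X p s hp =>
      obtain ⟨p', hp'⟩ := hp
      obtain ⟨s', hs'⟩ := hsymb s
      exact ⟨p' * s', by rw [map_mul, hp', hs', map_mul, map_mul]⟩
  -- the generators `y/y₁³` are values of the chart map
  have hgen : ∀ l : Fin 7, am (cc l) * ι ∈ Set.range (φ : MvPolynomial (Fin n) k →+* L) := by
    intro l
    fin_cases l
    · refine ⟨X a ^ 3 * X c, ?_⟩
      rw [RingHom.coe_coe, map_mul, map_pow, hφa, hφc]
      change _ = am (cc 0) * ι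
      linear_combination (ι ^ 4) * ra +
        (-(ι ^ 3 * am (cc 5) ^ 3 * am (cc 2)) +
          am (cc 0) * ι * ((am (cc 2) * ι) ^ 2 + am (cc 2) * ι + 1)) * hinv
    · refine ⟨X b ^ 3 * X c, ?_⟩
      rw [RingHom.coe_coe, map_mul, map_pow, hφb, hφc]
      change _ = am (cc 1) * ι
      linear_combination (ι ^ 4) * rb +
        (-(ι ^ 3 * am (cc 6) ^ 3 * am (cc 2)) +
          am (cc 1) * ι * ((am (cc 2) * ι) ^ 2 + am (cc 2) * ι + 1)) * hinv
    · exact ⟨1, by rw [map_one]; exact hinv.symm⟩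
    · refine ⟨X a ^ 2 * X b * X c, ?_⟩
      rw [RingHom.coe_coe, map_mul, map_mul, map_pow, hφa, hφb, hφc]
      change _ = am (cc 3) * ι
      linear_combination (ι ^ 4) * r3 +
        (-(ι ^ 3 * am (cc 5) ^ 2 * am (cc 6) * am (cc 2)) +
          am (cc 3) * ι * ((am (cc 2) * ι) ^ 2 + am (cc 2) * ι + 1)) * hinv
    · refine ⟨X a * X b ^ 2 * X c, ?_⟩
      rw [RingHom.coe_coe, map_mul, map_mul, map_pow, hφa, hφb, hφc]
      change _ = am (cc 4) * ι
      linear_combination (ι ^ 4) * r4 +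
        (-(ι ^ 3 * am (cc 5) * am (cc 6) ^ 2 * am (cc 2)) +
          am (cc 4) * ι * ((am (cc 2) * ι) ^ 2 + am (cc 2) * ι + 1)) * hinv
    · exact ⟨X a, by rw [RingHom.coe_coe, hφa]; rfl⟩
    · exact ⟨X b, by rw [RingHom.coe_coe, hφb]; rfl⟩
  have hrange := JordanThree.range_eq_blowupAlgebra_of_chart cc 2
    (φ : MvPolynomial (Fin n) k →+* L) hmem hbase hgen
  exact JordanThree.isRegularRing_chartRing_of_chart cc 2 (φ : MvPolynomial (Fin n) k →+* L)
    hinj hrange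

end Summit.ResolutionOfSingularities.ResolutionOfSingularities.Theorems.WildQuotientResolution.Third112

end
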